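import Summits.CriticalPhenomena.PercolationContinuityZ3.Theorems.PercNearOneGluingNoHeavyLowerTailFourPointFaceDefs
import Summits.CriticalPhenomena.PercolationContinuityZ3.Theorems.PercNearOneGluingNoHeavyLowerTailCubicThreePointBernsteinStep
import Mathlib.Tactic.Ring
import Mathlib.Tactic.Linarith
import Mathlib.Tactic.Positivity
import HarnessLib

/-!
# `NoHeavyLowerTail` (stmt-CriticalPhenomena-4575) — (L1)/(L2) FACE-FIRST: the cut-vertex face, its ideal, the isolated-terminal
# strata, and the bridge to the Bernstein pieces

Support file (prover prim-l12-p6, line P6 "stratified / face-first"; `--supports stmt-CriticalPhenomena-4575`).  Pure algebra over a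
commutative ring / `ℝ`: `ring` identities and elementary sign arguments; no measure theory, no named facts, no sorries.  Cell forms
`polL₁`, `polL₂`, `hybE₁`, `hybE₂`, `hybE₃g`, `E3h`, `Hh` from `…FourPointFaceDefs` (15 cell variables of the four-point law of
`(a,b,c,y)`, bound in the order of `CubicThreePointStep.threeB₁_polarization`); `F`, `threeB₁`, `threeB₂` from
`…CubicThreePointBernsteinStep`.  The measure-level targets are `PolarisedRowL1/L2` (`…GroupSepHybridRows`).

RESULTS.
* `threeB₁_eq_polL₁`, `threeB₂_eq_polL₂` — BRIDGE: the Bernstein pieces of SHK3⁺ along the apex edge are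
  `threeB₁ = polL₁ + F(x⁰) + (β₁+β₂)·Hh(D_ab,D_ac)` and `threeB₂ = polL₂ + (β₁+β₂)·(Hh(D_ac,G_ab) + Hh(G_ac,D_ab))`
  (an independent re-derivation of (P1′),(P2′) of `…CubicThreePointPolarization` against the new named forms).
* `hybE₁_swap_bc`, `polL₁_swap_bc`, `polL₂_swap_bc` — the `b ↔ c` relabelling maps `hybE₁ ↦ hybE₂` and fixes `polL₁`, `polL₂`.
* THE CUT-VERTEX FACE (`b` separates `{a,y}` from `c`): the law is `x = p ⊗ r` — the five cells in which `c` is joined to `a` or `y` but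
  not to `b` vanish (`«a|b|cy» = «ac|b|y» = «ac|by» = «acy|b» = «ab|cy» = 0`) and the other ten are the products
  `p(π)·r(s)` of the law `p` of `(a,b,y)` on the `{a,y}`-side (cells `pQ,pAB,pAY,pBY,pT` = `a|b|y, ab|y, ay|b, a|by, aby`) with the law
  `r = (r₀, r₁)` of `b≁c / b~c` on the `c`-side.  On it: `hybE₁ = 0`, `hybE₂ = σ·β₃·m(D_bc)` (`= σ₁(r₀+r₁)·pBY r₁·σ₁ r₀`), `hybE₃g = 0`,
  `F(x⁰) = 0`, hence `polL₁ = polL₂ = 0` and `threeB₁ = threeB₂ = 0` (`*_face`).  By the swap lemmas the same holds on the mirror face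
  (`c` separates `{a,y}` from `b`) with the roles of `hybE₁`, `hybE₂` exchanged.  These are exactly the equality classes
  `{E1 = 0, E2 = β₃L(D_bc) > 0}` / `{E1 = β₃L(D_bc) > 0, E2 = 0}` of the census (ttrl2 bern4 'POLARIZATION L1/L2').
* `polL₁_mem_faceIdeal` — ALGEBRAIC CHARACTERISATION: as a polynomial identity in the 15 free cell variables,
  `polL₁ = Σ_(5 zero cells z) z·q_z + Σ_(10 minors M) M·ℓ_M` with explicit quadratic `q_z` and linear `ℓ_M`, where the `M` are the `2×2`
  minors of the `5×2` matrix `(cell(π, b|c), cell(π, bc))_π` — i.e. `polL₁` lies in the ideal of the Segre variety "five cells `= 0`,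
  rank one", which is the Zariski closure of the cut-vertex face.
* ISOLATED-TERMINAL STRATA: `polL₁_aIsolated : polL₁ = σ·Hh(σ; m(b≁c), m(y≁{b,c}); m(b|c|y))` (one Harris form of the 3-point law of
  `(b,c,y)` — nonnegative by Harris, `polL₁_nonneg_aIsolated`), `polL₁_yIsolated : polL₁ = 2·F(q,u₁,u₂,u₃,t)` (twice SHK3⁺ of `(a,b,c)`,
  `polL₁_nonneg_yIsolated`), `polL₁_bIsolated = polL₁_cIsolated = 0`.  So on the isolated strata (L1) is Harris, resp. SHK3⁺, resp. trivial.
The first-order (normal-derivative) analysis off the face is in the companion `…FourPointFaceFirstOrder`.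
[cite: GladkovZimin2024HK, §4 (coordinate induction; the forms and the face analysis are this programme's)]
-/

namespace Summit.CriticalPhenomena.PercolationContinuityZ3.Theorems

namespace CubicFourPoint

open CubicThreePointStep

variable {R : Type*} [CommRing R]

/-! ### Bridge to the Bernstein pieces of SHK3⁺ -/

set_option maxRecDepth 10000 in
set_option maxHeartbeats 1600000 in
/-- **(P1′) against the named forms**: `threeB₁(x⁰; α,β) = polL₁ + F(x⁰) + (β₁+β₂)·Hh(σ; m(D_ab), m(D_ac); m(D_ab ∩ D_ac))`, where
`x⁰ = (q,u₁,u₂,u₃,t)` are the `(a,b,c)`-marginals of the 15 cells and `α₁ = «a|by|c»`, `α₂ = «a|b|cy»`, `β₁ = «ab|cy»`, `β₂ = «ac|by»`,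
`β₃ = «a|bcy»`. [this work] -/
theorem threeB₁_eq_polL₁ («a|b|c|y» «a|b|cy» «a|by|c» «a|bc|y» «ay|b|c» «ac|b|y» «ab|c|y» «a|bcy» «ay|bc» «ac|by» «acy|b» «ab|cy» «aby|c» «abc|y» «abcy» : R) :
    threeB₁ («a|b|c|y» + «a|b|cy» + «a|by|c» + «ay|b|c») («ab|c|y» + «ab|cy» + «aby|c») («ac|b|y» + «ac|by» + «acy|b») («a|bc|y» + «a|bcy» + «ay|bc») («abc|y» + «abcy») «a|by|c» «a|b|cy» «ab|cy» «ac|by» «a|bcy»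
      = polL₁ «a|b|c|y» «a|b|cy» «a|by|c» «a|bc|y» «ay|b|c» «ac|b|y» «ab|c|y» «a|bcy» «ay|bc» «ac|by» «acy|b» «ab|cy» «aby|c» «abc|y» «abcy» + F («a|b|c|y» + «a|b|cy» + «a|by|c» + «ay|b|c») («ab|c|y» + «ab|cy» + «aby|c») («ac|b|y» + «ac|by» + «acy|b») («a|bc|y» + «a|bcy» + «ay|bc») («abc|y» + «abcy»)
        + («ab|cy» + «ac|by») * Hh («a|b|c|y» + «a|b|cy» + «a|by|c» + «a|bc|y» + «ay|b|c» + «ac|b|y» + «ab|c|y» + «a|bcy» + «ay|bc» + «ac|by» + «acy|b» + «ab|cy» + «aby|c» + «abc|y» + «abcy») («a|b|c|y» + «a|b|cy» + «a|by|c» + «a|bc|y» + «ay|b|c» + «ac|b|y» + «a|bcy» + «ay|bc» + «ac|by» + «acy|b») («a|b|c|y» + «a|b|cy» + «a|by|c» + «a|bc|y» + «ay|b|c» + «ab|c|y» + «a|bcy» + «ay|bc» + «ab|cy» + «aby|c») («a|b|c|y» + «a|b|cy» + «a|by|c» + «a|bc|y» + «ay|b|c» + «a|bcy» + «ay|bc»)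 := by
  simp only [threeB₁, F, polL₁, hybE₁, hybE₂, E3h, Hh]
  ring

set_option maxRecDepth 10000 in
set_option maxHeartbeats 1600000 in
/-- **(P2′) against the named forms**: `threeB₂(x⁰; α,β) = polL₂ + (β₁+β₂)·(Hh(D_ac,G_ab) + Hh(G_ac,D_ab))`. [this work] -/
theorem threeB₂_eq_polL₂ («a|b|c|y» «a|b|cy» «a|by|c» «a|bc|y» «ay|b|c» «ac|b|y» «ab|c|y» «a|bcy» «ay|bc» «ac|by» «acy|b» «ab|cy» «aby|c» «abc|y» «abcy» : R) :
    threeB₂ («a|b|c|y» + «a|b|cy» + «a|by|c» + «ay|b|c») («ab|c|y» + «ab|cy» + «aby|c») («ac|b|y» + «ac|by» + «acy|b») («a|bc|y» + «a|bcy» + «ay|bc») («abc|y» + «abcy») «a|by|c» «a|b|cy» «ab|cy» «ac|by» «a|bcy»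
      = polL₂ «a|b|c|y» «a|b|cy» «a|by|c» «a|bc|y» «ay|b|c» «ac|b|y» «ab|c|y» «a|bcy» «ay|bc» «ac|by» «acy|b» «ab|cy» «aby|c» «abc|y» «abcy»
        + («ab|cy» + «ac|by») * (Hh («a|b|c|y» + «a|b|cy» + «a|by|c» + «a|bc|y» + «ay|b|c» + «ac|b|y» + «ab|c|y» + «a|bcy» + «ay|bc» + «ac|by» + «acy|b» + «ab|cy» + «aby|c» + «abc|y» + «abcy») («a|b|c|y» + «a|b|cy» + «a|by|c» + «a|bc|y» + «ay|b|c» + «ab|c|y» + «a|bcy» + «ay|bc» + «ab|cy» + «aby|c») («a|b|c|y» + «a|b|cy» + «a|bc|y» + «ay|b|c» + «ac|b|y» + «ay|bc» + «acy|b») («a|b|c|y» + «a|b|cy» + «a|bc|y» + «ay|b|c» + «ay|bc») + Hh («a|b|c|y» + «a|b|cy» + «a|by|c» + «a|bc|y» + «ay|b|c» + «ac|b|y» + «ab|c|y» + «a|bcy» + «ay|bc» + «ac|by» + «acy|b» + «ab|cy» + «aby|c» + «abc|y» + «abcy») («a|b|c|y» + «a|by|c» + «a|bc|y» + «ay|b|c»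 + «ab|c|y» + «ay|bc» + «aby|c») («a|b|c|y» + «a|b|cy» + «a|by|c» + «a|bc|y» + «ay|b|c» + «ac|b|y» + «a|bcy» + «ay|bc» + «ac|by» + «acy|b») («a|b|c|y» + «a|by|c» + «a|bc|y» + «ay|b|c» + «ay|bc»)) := by
  simp only [threeB₂, polL₂, hybE₁, hybE₂, hybE₃g, E3h, Hh]
  ring

/-! ### The `b ↔ c` relabelling -/

set_option maxRecDepth 10000 in
set_option maxHeartbeats 800000 in
/-- `b ↔ c` maps the hybrid row (E1) to its mirror (E2). [this work] -/
theorem hybE₁_swap_bc («a|b|c|y» «a|b|cy» «a|by|c» «a|bc|y» «ay|b|c» «ac|b|y» «ab|c|y» «a|bcy» «ay|bc» «ac|by» «acy|b» «ab|cy» «aby|c» «abc|y» «abcy» : R) :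
    hybE₁ «a|b|c|y» «a|by|c» «a|b|cy» «a|bc|y» «ay|b|c» «ab|c|y» «ac|b|y» «a|bcy» «ay|bc» «ab|cy» «aby|c» «ac|by» «acy|b» «abc|y» «abcy» = hybE₂ «a|b|c|y» «a|b|cy» «a|by|c» «a|bc|y» «ay|b|c» «ac|b|y» «ab|c|y» «a|bcy» «ay|bc» «ac|by» «acy|b» «ab|cy» «aby|c» «abc|y» «abcy» := by
  simp only [hybE₁, hybE₂, E3h]
  ring

set_option maxRecDepth 10000 in
set_option maxHeartbeats 800000 in
/-- `polL₁` is `b ↔ c` symmetric. [this work] -/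
theorem polL₁_swap_bc («a|b|c|y» «a|b|cy» «a|by|c» «a|bc|y» «ay|b|c» «ac|b|y» «ab|c|y» «a|bcy» «ay|bc» «ac|by» «acy|b» «ab|cy» «aby|c» «abc|y» «abcy» : R) :
    polL₁ «a|b|c|y» «a|by|c» «a|b|cy» «a|bc|y» «ay|b|c» «ab|c|y» «ac|b|y» «a|bcy» «ay|bc» «ab|cy» «aby|c» «ac|by» «acy|b» «abc|y» «abcy» = polL₁ «a|b|c|y» «a|b|cy» «a|by|c» «a|bc|y» «ay|b|c» «ac|b|y» «ab|c|y» «a|bcy» «ay|bc» «ac|by» «acy|b» «ab|cy» «aby|c» «abc|y» «abcy» := by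
  simp only [polL₁, hybE₁, hybE₂, E3h]
  ring

set_option maxRecDepth 10000 in
set_option maxHeartbeats 800000 in
/-- `polL₂` is `b ↔ c` symmetric. [this work] -/
theorem polL₂_swap_bc («a|b|c|y» «a|b|cy» «a|by|c» «a|bc|y» «ay|b|c» «ac|b|y» «ab|c|y» «a|bcy» «ay|bc» «ac|by» «acy|b» «ab|cy» «aby|c» «abc|y» «abcy» : R) :
    polL₂ «a|b|c|y» «a|by|c» «a|b|cy» «a|bc|y» «ay|b|c» «ab|c|y» «ac|b|y» «a|bcy» «ay|bc» «ab|cy» «aby|c» «ac|by» «acy|b» «abc|y» «abcy» = polL₂ «a|b|c|y» «a|b|cy» «a|by|c» «a|bc|y» «ay|b|c» «ac|b|y» «ab|c|y» «a|bcy» «ay|bc» «ac|by» «acy|b» «ab|cy» «aby|c» «abc|y» «abcy» := by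
  simp only [polL₂, hybE₁, hybE₂, hybE₃g, E3h]
  ring

/-! ### The cut-vertex face: `b` separates `{a,y}` from `c`

Parametrisation: `p = (pQ, pAB, pAY, pBY, pT)` the law of `(a,b,y)` on the side containing `a, y` (cells `a|b|y, ab|y, ay|b, a|by, aby`),
`r = (r₀, r₁)` the masses of `b≁c`, `b~c` on the side containing `c`; the 15 cells are `«π ∪ c-block»= p(π)·r(s)` and the five cells
`«a|b|cy», «ac|b|y», «ac|by», «acy|b», «ab|cy»` (c joined to `a` or `y` past `b`) are `0`. -/

/-- On the cut-vertex face the hybrid row (E1) vanishes identically. [this work] -/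
theorem hybE₁_face (pQ pAB pAY pBY pT r₀ r₁ : R) :
    hybE₁ (pQ * r₀) 0 (pBY * r₀) (pQ * r₁) (pAY * r₀) 0 (pAB * r₀) (pBY * r₁) (pAY * r₁) 0 0 0 (pT * r₀) (pAB * r₁) (pT * r₁) = 0 := by
  simp only [hybE₁, E3h]
  ring

/-- On the cut-vertex face the mirror row (E2) equals `σ·β₃·m(D_bc)` = `(σ₁(r₀+r₁))·(pBY·r₁)·(σ₁·r₀)`, `σ₁ = pQ+pAB+pAY+pBY+pT`. [this work] -/
theorem hybE₂_face (pQ pAB pAY pBY pT r₀ r₁ : R) :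
    hybE₂ (pQ * r₀) 0 (pBY * r₀) (pQ * r₁) (pAY * r₀) 0 (pAB * r₀) (pBY * r₁) (pAY * r₁) 0 0 0 (pT * r₀) (pAB * r₁) (pT * r₁)
      = ((pQ + pAB + pAY + pBY + pT) * (r₀ + r₁)) * (pBY * r₁) * ((pQ + pAB + pAY + pBY + pT) * r₀) := by
  simp only [hybE₂, E3h]
  ring

/-- On the cut-vertex face the shape-(i) row `E3(D_bc, G_ac, G_ab)` vanishes identically. [this work] -/
theorem hybE₃g_face (pQ pAB pAY pBY pT r₀ r₁ : R) :
    hybE₃g (pQ * r₀) 0 (pBY * r₀) (pQ * r₁) (pAY * r₀) 0 (pAB * r₀) (pBY * r₁) (pAY * r₁) 0 0 0 (pT * r₀) (pAB * r₁) (pT * r₁) = 0 := by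
  simp only [hybE₃g, E3h]
  ring

/-- On the cut-vertex face SHK3⁺ of the `(a,b,c)`-marginal vanishes: `F(x⁰) = 0` (`b` is a cut vertex between `a` and `c`). [this work] -/
theorem F_face (pQ pAB pAY pBY pT r₀ r₁ : R) :
    F (pQ * r₀ + 0 + pBY * r₀ + pAY * r₀) (pAB * r₀ + 0 + pT * r₀) (0 + 0 + 0) (pQ * r₁ + pBY * r₁ + pAY * r₁) (pAB * r₁ + pT * r₁) = (0 : R) := by
  simp only [F]
  ring

/-- **Face identity for (L1)**: `polL₁ = 0` identically on the cut-vertex face. [this work] -/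
theorem polL₁_face (pQ pAB pAY pBY pT r₀ r₁ : R) :
    polL₁ (pQ * r₀) 0 (pBY * r₀) (pQ * r₁) (pAY * r₀) 0 (pAB * r₀) (pBY * r₁) (pAY * r₁) 0 0 0 (pT * r₀) (pAB * r₁) (pT * r₁) = 0 := by
  simp only [polL₁, hybE₁, hybE₂, E3h]
  ring

/-- **Face identity for (L2)**: `polL₂ = 0` identically on the cut-vertex face. [this work] -/
theorem polL₂_face (pQ pAB pAY pBY pT r₀ r₁ : R) :
    polL₂ (pQ * r₀) 0 (pBY * r₀) (pQ * r₁) (pAY * r₀) 0 (pAB * r₀) (pBY * r₁) (pAY * r₁) 0 0 0 (pT * r₀) (pAB * r₁) (pT * r₁) = 0 := by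
  simp only [polL₂, hybE₁, hybE₂, hybE₃g, E3h]
  ring

/-- On the cut-vertex face both Bernstein pieces of SHK3⁺ vanish: `threeB₁ = 0` (the transition cells `β₁ = «ab|cy»`, `β₂ = «ac|by»`
are among the five zero cells). [this work] -/
theorem threeB₁_face (pQ pAB pAY pBY pT r₀ r₁ : R) :
    threeB₁ (pQ * r₀ + 0 + pBY * r₀ + pAY * r₀) (pAB * r₀ + 0 + pT * r₀) (0 + 0 + 0) (pQ * r₁ + pBY * r₁ + pAY * r₁) (pAB * r₁ + pT * r₁)
      (pBY * r₀) 0 0 0 (pBY * r₁) = (0 : R) := by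
  simp only [threeB₁]
  ring

/-- … and `threeB₂ = 0` on the cut-vertex face. [this work] -/
theorem threeB₂_face (pQ pAB pAY pBY pT r₀ r₁ : R) :
    threeB₂ (pQ * r₀ + 0 + pBY * r₀ + pAY * r₀) (pAB * r₀ + 0 + pT * r₀) (0 + 0 + 0) (pQ * r₁ + pBY * r₁ + pAY * r₁) (pAB * r₁ + pT * r₁)
      (pBY * r₀) 0 0 0 (pBY * r₁) = (0 : R) := by
  simp only [threeB₂]
  ring

/-! ### Algebraic characterisation: `polL₁` lies in the ideal of the Segre variety (closure of the face) -/

set_option maxRecDepth 10000 in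
set_option maxHeartbeats 1600000 in
/-- **`polL₁ ∈ (z₁,…,z₅, M₁,…,M₁₀)`**: an explicit polynomial identity `polL₁ = Σ_z z·q_z + Σ_M M·ℓ_M` over the five "zero cells"
`z ∈ {«ac|b|y», «ac|by», «acy|b», «a|b|cy», «ab|cy»}` and the ten `2×2` minors `M` of the matrix with rows
`(«a|b|c|y»,«a|bc|y»), («ab|c|y»,«abc|y»), («ay|b|c»,«ay|bc»), («a|by|c»,«a|bcy»), («aby|c»,«abcy»)` (found by exact linear algebra;
the certificate is not unique).  Consequently `polL₁` vanishes on every law with the five cells zero and that matrix of rank `≤ 1` —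
the Zariski closure of the cut-vertex face. [this work] -/
theorem polL₁_mem_faceIdeal («a|b|c|y» «a|b|cy» «a|by|c» «a|bc|y» «ay|b|c» «ac|b|y» «ab|c|y» «a|bcy» «ay|bc» «ac|by» «acy|b» «ab|cy» «aby|c» «abc|y» «abcy» : R) :
    polL₁ «a|b|c|y» «a|b|cy» «a|by|c» «a|bc|y» «ay|b|c» «ac|b|y» «ab|c|y» «a|bcy» «ay|bc» «ac|by» «acy|b» «ab|cy» «aby|c» «abc|y» «abcy»
      = «ac|b|y» * (-4 * «abcy» * «aby|c» - 2 * «abcy» * «ab|cy» - 4 * «abcy» * «ab|c|y» - 4 * «abcy» * «ay|bc» + 2 * «abcy» * «ay|b|c» - 2 * «abcy» * «a|bcy» - 4 * «abcy» * «a|bc|y» - «abcy» * «a|by|c» + «abcy» * «a|b|cy» + 2 * «abcy» * «a|b|c|y» - 4 * «abc|y» * «aby|c» - 2 * «abc|y» * «ab|cy» - 4 * «abc|y» * «ab|c|y» - 4 * «abc|y» * «ay|bc» + 2 * «abc|y» * «ay|b|c» - 2 * «abc|y» * «a|bcy» - 4 * «abc|y» * «a|bc|y» - «abc|y» * «a|by|c»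 + «abc|y» * «a|b|cy» + 2 * «abc|y» * «a|b|c|y» - 3 * «aby|c» * «ab|cy» - 4 * «aby|c» * «ab|c|y» - 4 * «aby|c» * «acy|b» - 3 * «aby|c» * «ac|by» - 2 * «aby|c» * «ac|b|y» - 8 * «aby|c» * «ay|bc» - 2 * «aby|c» * «ay|b|c» - 6 * «aby|c» * «a|bcy» - 8 * «aby|c» * «a|bc|y» - 3 * «aby|c» * «a|by|c» - 3 * «aby|c» * «a|b|cy» - 2 * «aby|c» * «a|b|c|y» - 2 * «aby|c» ^ 2 - 3 * «ab|cy» * «ab|c|y» - 2 * «ab|cy» * «acy|b» - «ab|cy» * «ac|by» - «ab|cy» * «ac|b|y» - 6 * «ab|cy» * «ay|bc» - 4 * «ab|cy» * «a|bcy» - 6 * «ab|cy» * «a|bc|y» - «ab|cy» * «a|by|c» - «ab|cy» * «a|b|cy» - «ab|cy» ^ 2 - 4 * «ab|c|y» * «acy|b» - 3 * «ab|c|y» * «ac|by» - 2 * «ab|c|y» * «ac|b|y» - 8 * «ab|c|y» * «ay|bc» - 2 * «ab|c|y» * «ay|b|c» - 6 * «ab|c|y» * «a|bcy» - 8 * «ab|c|y»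 * «a|bc|y» - 3 * «ab|c|y» * «a|by|c» - 3 * «ab|c|y» * «a|b|cy» - 2 * «ab|c|y» * «a|b|c|y» - 2 * «ab|c|y» ^ 2 - 4 * «acy|b» * «ay|bc» - 2 * «acy|b» * «a|bcy» - 4 * «acy|b» * «a|bc|y» - 2 * «acy|b» * «a|by|c» - 4 * «ac|by» * «ay|bc» + «ac|by» * «ay|b|c» - 2 * «ac|by» * «a|bcy» - 4 * «ac|by» * «a|bc|y» - «ac|by» * «a|by|c» + «ac|by» * «a|b|cy» + «ac|by» * «a|b|c|y» - 2 * «ac|b|y» * «ay|bc» - «ac|b|y» * «a|bcy» - 2 * «ac|b|y» * «a|bc|y» - «ac|b|y» * «a|by|c» - 2 * «ay|bc» * «ay|b|c» - 4 * «ay|bc» * «a|bcy» - 4 * «ay|bc» * «a|bc|y» - 5 * «ay|bc» * «a|by|c» - 3 * «ay|bc» * «a|b|cy» - 2 * «ay|bc» * «a|b|c|y» - 2 * «ay|bc» ^ 2 - 2 * «ay|b|c» * «a|bc|y» - «ay|b|c» * «a|by|c» - 4 * «a|bcy» * «a|bc|y» - 3 * «a|bcy» * «a|by|c» - «a|bcy»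 * «a|b|cy» - 2 * «a|bcy» ^ 2 - 5 * «a|bc|y» * «a|by|c» - 3 * «a|bc|y» * «a|b|cy» - 2 * «a|bc|y» * «a|b|c|y» - 2 * «a|bc|y» ^ 2 - «a|by|c» * «a|b|cy» - «a|by|c» * «a|b|c|y» - «a|by|c» ^ 2)
      + «ac|by» * (-2 * «abcy» * «aby|c» - 2 * «abcy» * «ab|c|y» - 3 * «abcy» * «ay|bc» + 4 * «abcy» * «ay|b|c» - «abcy» * «a|bcy» - 3 * «abcy» * «a|bc|y» + «abcy» * «a|by|c» + 3 * «abcy» * «a|b|cy» + 4 * «abcy» * «a|b|c|y» - 2 * «abc|y» * «aby|c» - 2 * «abc|y» * «ab|c|y» - 3 * «abc|y» * «ay|bc» + 4 * «abc|y» * «ay|b|c» - «abc|y» * «a|bcy» - 3 * «abc|y» * «a|bc|y» + «abc|y» * «a|by|c» + 3 * «abc|y» * «a|b|cy» + 4 * «abc|y» * «a|b|c|y» - «aby|c» * «ab|cy» - 2 * «aby|c» * «ab|c|y» - 3 * «aby|c» * «acy|b» - «aby|c» * «ac|by» - 6 * «aby|c» * «ay|bc» - 4 * «aby|c» * «a|bcy»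 - 6 * «aby|c» * «a|bc|y» - «aby|c» * «a|by|c» - «aby|c» * «a|b|cy» - «aby|c» ^ 2 - «ab|cy» * «ab|c|y» - «ab|cy» * «acy|b» - 4 * «ab|cy» * «ay|bc» + 2 * «ab|cy» * «ay|b|c» - 2 * «ab|cy» * «a|bcy» - 4 * «ab|cy» * «a|bc|y» + «ab|cy» * «a|by|c» + «ab|cy» * «a|b|cy» + 2 * «ab|cy» * «a|b|c|y» - 3 * «ab|c|y» * «acy|b» - «ab|c|y» * «ac|by» - 6 * «ab|c|y» * «ay|bc» - 4 * «ab|c|y» * «a|bcy» - 6 * «ab|c|y» * «a|bc|y» - «ab|c|y» * «a|by|c» - «ab|c|y» * «a|b|cy» - «ab|c|y» ^ 2 - 4 * «acy|b» * «ay|bc» + «acy|b» * «ay|b|c» - 2 * «acy|b» * «a|bcy» - 4 * «acy|b» * «a|bc|y» - «acy|b» * «a|by|c» + «acy|b» * «a|b|cy» + «acy|b» * «a|b|c|y» - 2 * «ac|by» * «ay|bc» + «ac|by» * «ay|b|c» - «ac|by» * «a|bcy» - 2 * «ac|by» * «a|bc|y» + «ac|by» * «a|b|cy» + «ac|by» *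 «a|b|c|y» - 2 * «ay|bc» * «a|bcy» - 2 * «ay|bc» * «a|bc|y» - 3 * «ay|bc» * «a|by|c» - «ay|bc» * «a|b|cy» - «ay|bc» ^ 2 + 2 * «ay|b|c» * «a|bcy» + «ay|b|c» * «a|by|c» + 2 * «ay|b|c» * «a|b|cy» + 2 * «ay|b|c» * «a|b|c|y» + «ay|b|c» ^ 2 - 2 * «a|bcy» * «a|bc|y» - «a|bcy» * «a|by|c» + «a|bcy» * «a|b|cy» + 2 * «a|bcy» * «a|b|c|y» - «a|bcy» ^ 2 - 3 * «a|bc|y» * «a|by|c» - «a|bc|y» * «a|b|cy» - «a|bc|y» ^ 2 + «a|by|c» * «a|b|cy» + «a|by|c» * «a|b|c|y» + 2 * «a|b|cy» * «a|b|c|y» + «a|b|cy» ^ 2 + «a|b|c|y» ^ 2)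
      + «acy|b» * (-4 * «abcy» * «aby|c» - 2 * «abcy» * «ab|cy» - 4 * «abcy» * «ab|c|y» - 4 * «abcy» * «ay|bc» + 2 * «abcy» * «ay|b|c» - 2 * «abcy» * «a|bcy» - 4 * «abcy» * «a|bc|y» - «abcy» * «a|by|c» + «abcy» * «a|b|cy» + 2 * «abcy» * «a|b|c|y» - 4 * «abc|y» * «aby|c» - 2 * «abc|y» * «ab|cy» - 4 * «abc|y» * «ab|c|y» - 4 * «abc|y» * «ay|bc» + 2 * «abc|y» * «ay|b|c» - 2 * «abc|y» * «a|bcy» - 4 * «abc|y» * «a|bc|y» - «abc|y» * «a|by|c» + «abc|y» * «a|b|cy» + 2 * «abc|y» * «a|b|c|y» - 3 * «aby|c» * «ab|cy» - 4 * «aby|c» * «ab|c|y» - 2 * «aby|c» * «acy|b» - 8 * «aby|c» * «ay|bc» - 2 * «aby|c» * «ay|b|c» - 6 * «aby|c» * «a|bcy» - 8 * «aby|c» * «a|bc|y» - 3 * «aby|c» * «a|by|c» - 3 * «aby|c» * «a|b|cy» - 2 * «aby|c» * «a|b|c|y» - 2 * «aby|c» ^ 2 - 3 * «ab|cy» * «ab|c|y»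 - «ab|cy» * «acy|b» - 6 * «ab|cy» * «ay|bc» - 4 * «ab|cy» * «a|bcy» - 6 * «ab|cy» * «a|bc|y» - «ab|cy» * «a|by|c» - «ab|cy» * «a|b|cy» - «ab|cy» ^ 2 - 2 * «ab|c|y» * «acy|b» - 8 * «ab|c|y» * «ay|bc» - 2 * «ab|c|y» * «ay|b|c» - 6 * «ab|c|y» * «a|bcy» - 8 * «ab|c|y» * «a|bc|y» - 3 * «ab|c|y» * «a|by|c» - 3 * «ab|c|y» * «a|b|cy» - 2 * «ab|c|y» * «a|b|c|y» - 2 * «ab|c|y» ^ 2 - 2 * «acy|b» * «ay|bc» - «acy|b» * «a|bcy» - 2 * «acy|b» * «a|bc|y» - «acy|b» * «a|by|c» - 2 * «ay|bc» * «ay|b|c» - 4 * «ay|bc» * «a|bcy» - 4 * «ay|bc» * «a|bc|y» - 5 * «ay|bc» * «a|by|c» - 3 * «ay|bc» * «a|b|cy» - 2 * «ay|bc» * «a|b|c|y» - 2 * «ay|bc» ^ 2 - 2 * «ay|b|c» * «a|bc|y» - «ay|b|c» * «a|by|c» - 4 * «a|bcy» * «a|bc|y» - 3 * «a|bcy» *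 «a|by|c» - «a|bcy» * «a|b|cy» - 2 * «a|bcy» ^ 2 - 5 * «a|bc|y» * «a|by|c» - 3 * «a|bc|y» * «a|b|cy» - 2 * «a|bc|y» * «a|b|c|y» - 2 * «a|bc|y» ^ 2 - «a|by|c» * «a|b|cy» - «a|by|c» * «a|b|c|y» - «a|by|c» ^ 2)
      + «a|b|cy» * (4 * «abcy» * «abc|y» - «abcy» * «aby|c» + «abcy» * «ab|cy» - «abcy» * «ab|c|y» - «abcy» * «ay|bc» + 3 * «abcy» * «ay|b|c» + 2 * «abcy» * «a|bcy» - «abcy» * «a|bc|y» + 2 * «abcy» * «a|by|c» + «abcy» * «a|b|cy» + 3 * «abcy» * «a|b|c|y» + 2 * «abcy» ^ 2 - «abc|y» * «aby|c» + «abc|y» * «ab|cy» - «abc|y» * «ab|c|y» - «abc|y» * «ay|bc» + 3 * «abc|y» * «ay|b|c» + 2 * «abc|y» * «a|bcy» - «abc|y» * «a|bc|y» + 2 * «abc|y» * «a|by|c» + «abc|y» * «a|b|cy» + 3 * «abc|y» * «a|b|c|y» + 2 * «abc|y» ^ 2 - «aby|c» * «ab|cy» - 2 * «aby|c» * «ab|c|y»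 - 5 * «aby|c» * «ay|bc» - «aby|c» * «ay|b|c» - 3 * «aby|c» * «a|bcy» - 5 * «aby|c» * «a|bc|y» - «aby|c» * «a|by|c» - «aby|c» * «a|b|cy» - «aby|c» * «a|b|c|y» - «aby|c» ^ 2 - «ab|cy» * «ab|c|y» - 3 * «ab|cy» * «ay|bc» + «ab|cy» * «ay|b|c» - «ab|cy» * «a|bcy» - 3 * «ab|cy» * «a|bc|y» + «ab|cy» * «a|by|c» + «ab|cy» * «a|b|c|y» - 5 * «ab|c|y» * «ay|bc» - «ab|c|y» * «ay|b|c» - 3 * «ab|c|y» * «a|bcy» - 5 * «ab|c|y» * «a|bc|y» - «ab|c|y» * «a|by|c» - «ab|c|y» * «a|b|cy» - «ab|c|y» * «a|b|c|y» - «ab|c|y» ^ 2 - «ay|bc» * «ay|b|c» - «ay|bc» * «a|bcy» - 2 * «ay|bc» * «a|bc|y» - 2 * «ay|bc» * «a|by|c» - «ay|bc» * «a|b|cy» - «ay|bc» * «a|b|c|y» - «ay|bc» ^ 2 + «ay|b|c» * «a|bcy» - «ay|b|c» * «a|bc|y» - «a|bcy» * «a|bc|y» + «a|bcy» * «a|b|c|y»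 - 2 * «a|bc|y» * «a|by|c» - «a|bc|y» * «a|b|cy» - «a|bc|y» * «a|b|c|y» - «a|bc|y» ^ 2)
      + «ab|cy» * (-3 * «abcy» * «ay|bc» + 4 * «abcy» * «ay|b|c» - «abcy» * «a|bcy» - 3 * «abcy» * «a|bc|y» + 3 * «abcy» * «a|by|c» + 4 * «abcy» * «a|b|c|y» - 3 * «abc|y» * «ay|bc» + 4 * «abc|y» * «ay|b|c» - «abc|y» * «a|bcy» - 3 * «abc|y» * «a|bc|y» + 3 * «abc|y» * «a|by|c» + 4 * «abc|y» * «a|b|c|y» - 4 * «aby|c» * «ay|bc» + «aby|c» * «ay|b|c» - 2 * «aby|c» * «a|bcy» - 4 * «aby|c» * «a|bc|y» + «aby|c» * «a|by|c» + «aby|c» * «a|b|c|y» - 2 * «ab|cy» * «ay|bc» + «ab|cy» * «ay|b|c» - «ab|cy» * «a|bcy» - 2 * «ab|cy» * «a|bc|y» + «ab|cy» * «a|by|c» + «ab|cy» * «a|b|c|y» - 4 * «ab|c|y» * «ay|bc» + «ab|c|y» * «ay|b|c» - 2 * «ab|c|y» * «a|bcy» - 4 * «ab|c|y» * «a|bc|y»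 + «ab|c|y» * «a|by|c» + «ab|c|y» * «a|b|c|y» - 2 * «ay|bc» * «a|bcy» - 2 * «ay|bc» * «a|bc|y» - «ay|bc» * «a|by|c» - «ay|bc» ^ 2 + 2 * «ay|b|c» * «a|bcy» + 2 * «ay|b|c» * «a|by|c» + 2 * «ay|b|c» * «a|b|c|y» + «ay|b|c» ^ 2 - 2 * «a|bcy» * «a|bc|y» + «a|bcy» * «a|by|c» + 2 * «a|bcy» * «a|b|c|y» - «a|bcy» ^ 2 - «a|bc|y» * «a|by|c» - «a|bc|y» ^ 2 + 2 * «a|by|c» * «a|b|c|y» + «a|by|c» ^ 2 + «a|b|c|y» ^ 2)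
      + («abc|y» * «a|b|c|y» - «ab|c|y» * «a|bc|y») * (4 * «abcy» + 4 * «abc|y» + 2 * «aby|c» + 2 * «ab|c|y» + 4 * «ay|bc» + 4 * «ay|b|c» + 4 * «a|bcy» + 2 * «a|bc|y» + 3 * «a|by|c» + 2 * «a|b|c|y»)
      + («ay|bc» * «a|b|c|y» - «ay|b|c» * «a|bc|y») * (-2 * «abcy» - 2 * «abc|y» - 2 * «aby|c» - 2 * «ab|c|y» - «a|bcy» - «a|by|c»)
      + («a|bcy» * «a|b|c|y» - «a|bc|y» * «a|by|c») * («abcy» + «abc|y» + 2 * «ay|bc» + 2 * «ay|b|c» + «a|bcy» + «a|bc|y» + «a|by|c» + «a|b|c|y»)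
      + («abcy» * «a|b|c|y» - «aby|c» * «a|bc|y») * (4 * «abcy» + 4 * «abc|y» + 2 * «aby|c» + 2 * «ab|c|y» + 4 * «ay|bc» + 4 * «ay|b|c» + 4 * «a|bcy» + 2 * «a|bc|y» + 3 * «a|by|c» + 2 * «a|b|c|y»)
      + (-«abc|y» * «ay|b|c» + «ab|c|y» * «ay|bc») * (-8 * «abcy» - 4 * «abc|y» - 4 * «aby|c» - 2 * «ab|c|y» - 2 * «ay|bc» - 2 * «ay|b|c» - 5 * «a|bcy» - 3 * «a|by|c»)
      + (-«abc|y» * «a|by|c» + «ab|c|y» * «a|bcy») * (-4 * «abcy» - 2 * «abc|y» - 2 * «aby|c» - «ab|c|y» + «ay|bc» - 2 * «a|bcy» - «a|by|c»)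
      + («abcy» * «ab|c|y» - «abc|y» * «aby|c») * (4 * «ay|bc» + 2 * «ay|b|c» + 2 * «a|bcy» + «a|by|c»)
      + (-«ay|bc» * «a|by|c» + «ay|b|c» * «a|bcy») * («abcy» + «ay|bc» + «ay|b|c» + «a|bcy» + «a|by|c»)
      + («abcy» * «ay|b|c» - «aby|c» * «ay|bc») * (4 * «abcy» + 2 * «aby|c» + 2 * «ay|bc» + 2 * «ay|b|c» + 4 * «a|bcy» + 3 * «a|by|c»)
      + («abcy» * «a|by|c» - «aby|c» * «a|bcy») * (2 * «abcy» + «aby|c» + 2 * «a|bcy» + «a|by|c») := by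
  simp only [polL₁, hybE₁, hybE₂, E3h]
  ring

/-! ### Isolated-terminal strata -/

/-- **`a` isolated**: if every cell joining `a` to another point vanishes, `polL₁ = σ·Hh(σ; m(b≁c), m(y≁b ∧ y≁c); m(b|c|y))` — `σ` times ONE
Harris form of the two decreasing events `{b≁c}`, `{y≁b, y≁c}` of the 3-point law `(Q,Ucy,Uby,Ubc,W)` of `(b,c,y)`
(cells `b|c|y, cy|b, by|c, bc|y, bcy`). [this work] -/
theorem polL₁_aIsolated (Q Ucy Uby Ubc W : R) :
    polL₁ Q Ucy Uby Ubc 0 0 0 W 0 0 0 0 0 0 0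
      = (Q + Ucy + Uby + Ubc + W) * Hh (Q + Ucy + Uby + Ubc + W) (Q + Uby + Ucy) (Q + Ubc) Q := by
  simp only [polL₁, hybE₁, hybE₂, E3h, Hh]
  ring

/-- Hence on the `a`-isolated stratum (L1) IS Harris: `0 ≤ polL₁` given total mass `σ ≥ 0` and the Harris inequality
`m(b≁c)·m(y≁{b,c}) ≤ σ·m(b|c|y)`. [this work] -/
theorem polL₁_nonneg_aIsolated {Q Ucy Uby Ubc W : ℝ} (hσ : 0 ≤ Q + Ucy + Uby + Ubc + W)
    (hH : (Q + Uby + Ucy) * (Q + Ubc) ≤ (Q + Ucy + Uby + Ubc + W) * Q) :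
    0 ≤ polL₁ Q Ucy Uby Ubc 0 0 0 W 0 0 0 0 0 0 0 := by
  rw [polL₁_aIsolated]
  exact mul_nonneg hσ (by simp only [Hh]; linarith)

/-- **`y` isolated**: if every cell joining `y` to another point vanishes, `polL₁ = 2·F(q,u₁,u₂,u₃,t)` — twice SHK3⁺ of the 3-point law
of `(a,b,c)` (`D[ay|b] = D_ab`, `D[ay|c] = D_ac`, `β₃ = 0`). [this work] -/
theorem polL₁_yIsolated (q u₁ u₂ u₃ t : R) :
    polL₁ q 0 0 u₃ 0 u₂ u₁ 0 0 0 0 0 0 t 0 = 2 * F q u₁ u₂ u₃ t := by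
  simp only [polL₁, hybE₁, hybE₂, E3h, F]
  ring

/-- Hence on the `y`-isolated stratum (L1) IS SHK3⁺: `0 ≤ polL₁` given `0 ≤ F(q,u₁,u₂,u₃,t)`. [this work] -/
theorem polL₁_nonneg_yIsolated {q u₁ u₂ u₃ t : ℝ} (hF : 0 ≤ F q u₁ u₂ u₃ t) :
    0 ≤ polL₁ q 0 0 u₃ 0 u₂ u₁ 0 0 0 0 0 0 t 0 := by
  rw [polL₁_yIsolated]
  linarith

/-- **`b` isolated**: every term of (L1) vanishes. [this work] -/
theorem polL₁_bIsolated (Q Ucy Uac Uay W : R) :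
    polL₁ Q Ucy 0 0 Uay Uac 0 0 0 0 W 0 0 0 0 = 0 := by
  simp only [polL₁, hybE₁, hybE₂, E3h]
  ring

/-- **`c` isolated**: every term of (L1) vanishes (the `r₁ = 0` edge of the cut-vertex face). [this work] -/
theorem polL₁_cIsolated (Q Uab Uay Uby W : R) :
    polL₁ Q 0 Uby 0 Uay 0 Uab 0 0 0 0 0 W 0 0 = 0 := by
  simp only [polL₁, hybE₁, hybE₂, E3h]
  ring

end CubicFourPoint

end Summit.CriticalPhenomena.PercolationContinuityZ3.Theorems
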